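import Mathlib
import Summits.NavierStokesRegularity.NavierStokesRegularity.Theorems.EulerZoomLiouvillePowerGaugeEulerLiouvilleDSSEndpointSobolevPeriodFlux
import HarnessLib

/-!
# Rung C2 of the crux `EulerZoomLiouville.PowerGaugeEulerLiouville` at the endpoint `ρ = 1/2`:
# the period-integrated flux of a scale against SUP-IN-TIME shell energies (power `3/4`, no growth bound)

Route №10 `EulerZoomLiouville` (NavierStokesRegularity), crux E = stmt-NavierStokesRegularity-19832,
stub `stub_nonSelfSimilarRest` (DSS endpoint stratum `IsDSSPowerSpread`).  The tree's
`EndpointSobolev.period_flux_le_of_weakGradient` (`…DSSEndpointSobolevPeriodFlux`) measures the window by the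
PERIOD-INTEGRATED shell energies and pays Hölder in time: window sum to the power `1/4`.  If instead every
window shell energy is bounded FOR A.E. SLICE of the period — `∫_{L'≤|y|<2L'} |u(τ)|² ≤ fb(L')` for a.e.
`τ ∈ I₀` — the one-slice Sobolev flux bound (`exists_slice_flux_consts_of_weakGradient`) integrates in time
with only `∫_{I₀} g^{3/4} ≤ |I₀|^{1/4} (∫_{I₀} g)^{3/4} ≲ M^{3/8}` (`g(τ) = ∫_{B_{32M}}|H(τ)|²_F`, `E`-gauge):

* `EndpointSobolev.period_flux_le_of_weakGradient_sup` —
  `∫_{I₀} ∫_{M≤|y|≤2M} (‖u‖³ + 2|p|‖u‖) ≤ a M^{3/8} S^{3/4} + b M^{−3/2} E₀ (τ₀−α) √S`,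
  `S = Σ_{k≤2m} fb(2^k L/2^m)` the window sum of the slice-wise bounds (same side conditions as the tree's).

With the slice-wise shell inequality (`dss_half_aeSliceShell_le`, `…DSSEndpointSobolevSliceShell`) this is
the recursion `f ≤ C₁ L^{−5/8} S^{3/4} + C₂ √S L^{−5/2}` of the CENTRED endpoint drain, now for DSS members:
least fixed point `5/2` (not `5/6`).

WHAT THIS IS NOT: not NS, not E, not the stub — the period input of the sup-in-time DSS endpoint drain.
[cite: ChaeShvydkoy2013, §3.1 proof of Thm. 3.1]
-/

noncomputable section

-- flat `Theorems/<Route><Decl>…` files of one crux share the namespace of the crux (tree convention)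
set_option linter.dupNamespace false

open MeasureTheory Set Filter Topology Metric Function TopologicalSpace
open scoped ENNReal NNReal InnerProductSpace RealInnerProductSpace

namespace Summit.NavierStokesRegularity.NavierStokesRegularity.Theorems.PowerGaugeEulerLiouville

open Literature.Analysis Literature.Analysis.FunctionSpaces Literature.Analysis.FluidPDE

namespace EndpointSobolev

section PeriodFlux

variable {u : ℝ → EuclideanSpace ℝ (Fin 3) → EuclideanSpace ℝ (Fin 3)}
  {p : ℝ → EuclideanSpace ℝ (Fin 3) → ℝ}
  {H : ℝ → EuclideanSpace ℝ (Fin 3) → EuclideanSpace ℝ (Fin 3) →L[ℝ] EuclideanSpace ℝ (Fin 3)}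

/-- **The period-integrated flux of a scale against sup-in-time window energies.**  See the module
docstring. [cite: ChaeShvydkoy2013, §3.1 proof of Thm. 3.1] -/
-- adapted from the tree's `period_flux_le_of_weakGradient` (…DSSEndpointSobolevPeriodFlux, this seat's F-c)
theorem period_flux_le_of_weakGradient_sup {c : ℝ≥0}
    (hsw : IsSuitableWeakSolutionOn (slab (EuclideanSpace ℝ (Fin 3)) (Iio 0) isOpen_Iio) 0 0 u p)
    (hH : HasWeakSpatialGradientOn (slab (EuclideanSpace ℝ (Fin 3)) (Iio 0) isOpen_Iio) u H)
    (hE : ∀ a : ℝ, 0 < a →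
      ENNReal.ofReal (a ^ (1 / 2 : ℝ)) * cknE a (0 : ℝ × EuclideanSpace ℝ (Fin 3)) H ≤ (c : ℝ≥0∞))
    {α τ₀ : ℝ} (hτ₀ : τ₀ < 0) (hα : α < τ₀) {E₀ : ℝ}
    (hEn : ∀ᵐ τ : ℝ, τ < 0 → Integrable (fun y => ‖u τ y‖ ^ 2) volume ∧ ∫ y, ‖u τ y‖ ^ 2 ≤ E₀)
    (h3 : ∀ᵐ τ : ℝ, τ < 0 → LocallyIntegrable (fun y => ‖u τ y‖ ^ 3) volume)
    (hPV : ∀ᵐ τ : ℝ, τ < 0 → LocallyIntegrable (fun y => |p τ y| * ‖u τ y‖) volume)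
    {R₁ : ℝ}
    (hPR : ∀ᵐ τ : ℝ, τ ∈ Ioo α τ₀ → ∀ R : ℝ, R₁ ≤ R → ∀ᵐ y ∂volume, ‖y‖ < R / 2 →
      p τ y = rieszPressure ((ball (0 : EuclideanSpace ℝ (Fin 3)) R).indicator (u τ)) y +
        ∫ z in {z | R ≤ ‖z‖}, pressureKernel (y - z) (u τ z))
    {fb : ℝ → ℝ} (hfb0 : ∀ L' : ℝ, 0 ≤ fb L')
    (hfb : ∀ L' : ℝ, 0 < L' → ∀ᵐ τ : ℝ, τ ∈ Ioo α τ₀ →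
      ∫ y in {y : EuclideanSpace ℝ (Fin 3) | L' ≤ ‖y‖ ∧ ‖y‖ < 2 * L'}, ‖u τ y‖ ^ 2 ≤ fb L')
    (m : ℕ) :
    ∃ a b : ℝ, 0 ≤ a ∧ 0 ≤ b ∧ ∀ L M : ℝ, 0 < L → 1 ≤ M → -((32 * M) ^ 2) ≤ α → R₁ ≤ 32 * M →
      L / 2 ^ m ≤ M / 8 → 32 * M ≤ 2 ^ (m + 1) * L →
      ∫ τ in Ioo α τ₀, ∫ y in {y : EuclideanSpace ℝ (Fin 3) | M ≤ ‖y‖ ∧ ‖y‖ ≤ 2 * M},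
          (‖u τ y‖ ^ 3 + 2 * (|p τ y| * ‖u τ y‖)) ≤
        a * M ^ (3 / 8 : ℝ) * (∑ k ∈ Finset.range (2 * m + 1), fb (2 ^ k * L / 2 ^ m)) ^ (3 / 4 : ℝ) +
          b * M ^ (-(3 / 2 : ℝ)) * E₀ * ((τ₀ - α) *
            Real.sqrt (∑ k ∈ Finset.range (2 * m + 1), fb (2 ^ k * L / 2 ^ m))) := by
  set I₀ : Set ℝ := Ioo α τ₀ with hI₀
  set T : ℝ := τ₀ - α with hT
  have hT0 : 0 < T := by rw [hT]; linarith
  have hTvol : volume.real I₀ = T := Real.volume_real_Ioo_of_le hα.le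
  have hI₀vol : volume I₀ ≠ ⊤ := by rw [hI₀, Real.volume_Ioo]; exact ENNReal.ofReal_ne_top
  have hI₀0 : I₀ ⊆ Iio 0 := fun t ht => ht.2.trans hτ₀
  obtain ⟨C_S, hCS⟩ := exists_eLpNorm_rieszPressure_two_le
  obtain ⟨a₁, bb, ha₁, hbb, hflux⟩ := exists_slice_flux_consts_of_weakGradient C_S
  have hum : AEStronglyMeasurable (uncurry u)
      (volume.restrict (Iio (0 : ℝ) ×ˢ (univ : Set (EuclideanSpace ℝ (Fin 3))))) := by
    obtain ⟨G, hG, -, -⟩ := hsw.localEnergy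
    simpa [slab] using hG.locallyIntegrableOn.aestronglyMeasurable
  have hHm : AEStronglyMeasurable (uncurry H)
      (volume.restrict (Iio (0 : ℝ) ×ˢ (univ : Set (EuclideanSpace ℝ (Fin 3))))) := by
    simpa [slab] using hH.locallyIntegrableOn_grad.aestronglyMeasurable
  obtain ⟨C', hslice⟩ := exists_ae_slice_energy_facts hsw (α := α) hτ₀ 1
  have hW := fun (A : Set (EuclideanSpace ℝ (Fin 3))) (hA : MeasurableSet A) =>
    period_sliceSetEnergy hum hEn (α := α) hτ₀ hA
  have hshellm : ∀ A B : ℝ, MeasurableSet {y : EuclideanSpace ℝ (Fin 3) | A ≤ ‖y‖ ∧ ‖y‖ < B} :=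
    fun A B => (measurableSet_le measurable_const measurable_norm).inter
      (measurableSet_lt measurable_norm measurable_const)
  have hE₀ : 0 ≤ E₀ := by
    have hne : (ae ((volume : Measure ℝ).restrict I₀)).NeBot := by
      rw [ae_neBot, Ne, Measure.restrict_eq_zero, Real.volume_Ioo, ENNReal.ofReal_eq_zero, not_le]
      linarith
    obtain ⟨τ, hτ, hτI⟩ := ((ae_restrict_of_ae hEn : ∀ᵐ τ ∂(volume.restrict I₀), _).and
      (ae_restrict_mem measurableSet_Ioo)).exists
    exact (integral_nonneg fun y => by positivity).trans (hτ (hI₀0 hτI)).2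
  have h8 : ∀ᵐ τ : ℝ, τ ∈ I₀ →
      HasWeakFDerivOn (⊤ : Opens (EuclideanSpace ℝ (Fin 3))) volume (u τ) (H τ) :=
    (ae_restrict_iff' measurableSet_Ioo).1 (hH.mono (slab_mono (Ioo_subset_Iio_self.trans
      (Iio_subset_Iio hτ₀.le)) : slab (EuclideanSpace ℝ (Fin 3)) (Ioo α τ₀) isOpen_Ioo ≤
        slab (EuclideanSpace ℝ (Fin 3)) (Iio 0) isOpen_Iio)).ae_hasWeakFDerivOn_slice_slab
  have hHm' : AEStronglyMeasurable (uncurry H)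
      (((volume : Measure ℝ).restrict I₀).prod (volume : Measure (EuclideanSpace ℝ (Fin 3)))) := by
    rw [Measure.restrict_prod_eq_prod_univ, ← Measure.volume_eq_prod]
    exact hHm.mono_measure (Measure.restrict_mono (prod_mono hI₀0 subset_rfl) le_rfl)
  have h9 : ∀ᵐ τ : ℝ, τ ∈ I₀ → AEStronglyMeasurable (H τ) volume :=
    (ae_restrict_iff' measurableSet_Ioo).1 hHm'.prodMk_left
  set a : ℝ := a₁ * (E₀ ^ (3 / 4 : ℝ) * T +
    T ^ (1 / 4 : ℝ) * ((c : ℝ) * (32 : ℝ) ^ (1 / 2 : ℝ)) ^ (3 / 4 : ℝ)) with ha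
  refine ⟨a, bb, by positivity, hbb, fun L M hL hM hMα hMR₁ hwA hwB => ?_⟩
  have hM0 : 0 < M := one_pos.trans_le hM
  set S : ℝ := ∑ k ∈ Finset.range (2 * m + 1), fb (2 ^ k * L / 2 ^ m) with hS
  have hS0 : 0 ≤ S := Finset.sum_nonneg fun k _ => hfb0 _
  set TM : Set (EuclideanSpace ℝ (Fin 3)) := {y | M / 8 ≤ ‖y‖ ∧ ‖y‖ < 32 * M} with hTM
  obtain ⟨hWi, hWb, hW0⟩ := hW TM (hshellm _ _)
  -- the window bound, slice by slice: `∫_{T_M} |u(τ)|² ≤ S` for a.e. `τ ∈ I₀`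
  have hWS : ∀ᵐ τ : ℝ, τ ∈ I₀ → ∫ y in TM, ‖u τ y‖ ^ 2 ≤ S := by
    have hk : ∀ k : ℕ, ∀ᵐ τ : ℝ, τ ∈ I₀ →
        ∫ y in {y : EuclideanSpace ℝ (Fin 3) | 2 ^ k * L / 2 ^ m ≤ ‖y‖ ∧
          ‖y‖ < 2 * (2 ^ k * L / 2 ^ m)}, ‖u τ y‖ ^ 2 ≤ fb (2 ^ k * L / 2 ^ m) :=
      fun k => hfb _ (by positivity)
    filter_upwards [ae_all_iff.2 hk, hEn] with τ hτ hEτ hτI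
    refine (setIntegral_le_windowSum (fun y => by positivity) (hEτ (hI₀0 hτI)).1 hL m hwA hwB).trans ?_
    exact Finset.sum_le_sum fun k _ => hτ k hτI
  set F : ℝ × EuclideanSpace ℝ (Fin 3) → ℝ≥0∞ := fun z => ENNReal.ofReal (frobeniusNormSq (H z.1 z.2))
    with hF
  have hFm : AEMeasurable F ((volume.restrict I₀).prod volume) :=
    (continuous_frobeniusNormSq'.comp_aestronglyMeasurable hHm').aemeasurable.ennreal_ofReal
  set gR : ℝ → ℝ≥0∞ := fun τ => ∫⁻ y in ball (0 : EuclideanSpace ℝ (Fin 3)) (32 * M), F (τ, y) with hgR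
  set f₁ : ℝ × EuclideanSpace ℝ (Fin 3) → ℝ≥0∞ := fun z =>
    ((univ : Set ℝ) ×ˢ ball (0 : EuclideanSpace ℝ (Fin 3)) (32 * M)).indicator F z with hf₁
  have hf₁m : AEMeasurable f₁ ((volume.restrict I₀).prod volume) :=
    hFm.indicator (MeasurableSet.univ.prod measurableSet_ball)
  have hg₁ : ∀ τ, (∫⁻ y, f₁ (τ, y)) = ∫⁻ y in ball (0 : EuclideanSpace ℝ (Fin 3)) (32 * M), F (τ, y) := by
    intro τ
    rw [← lintegral_indicator measurableSet_ball]
    congr 1; funext y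
    by_cases hy : y ∈ ball (0 : EuclideanSpace ℝ (Fin 3)) (32 * M)
    · rw [indicator_of_mem hy]
      exact indicator_of_mem (show (τ, y) ∈ (univ : Set ℝ) ×ˢ ball (0 : EuclideanSpace ℝ (Fin 3)) (32 * M)
        from ⟨mem_univ _, hy⟩) _
    · rw [indicator_of_notMem hy]
      exact indicator_of_notMem (fun h => hy h.2) _
  have hgRm : AEMeasurable gR (volume.restrict I₀) := by
    have h := hf₁m.lintegral_prod_right'
    simp_rw [hg₁] at h
    exact h
  have hprodI : (volume.restrict I₀).prod (volume : Measure (EuclideanSpace ℝ (Fin 3))) =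
      volume.restrict (I₀ ×ˢ (univ : Set (EuclideanSpace ℝ (Fin 3)))) := by
    rw [Measure.restrict_prod_eq_prod_univ, ← Measure.volume_eq_prod]
  have hTon : ∫⁻ τ in I₀, gR τ = ∫⁻ z in I₀ ×ˢ ball (0 : EuclideanSpace ℝ (Fin 3)) (32 * M), F z := by
    have h1 : ∫⁻ z, f₁ z ∂((volume.restrict I₀).prod volume) = ∫⁻ τ in I₀, ∫⁻ y, f₁ (τ, y) :=
      lintegral_prod _ hf₁m
    simp_rw [hg₁] at h1
    rw [← h1, hprodI, lintegral_indicator (MeasurableSet.univ.prod measurableSet_ball),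
      Measure.restrict_restrict (MeasurableSet.univ.prod measurableSet_ball), prod_inter_prod,
      univ_inter, inter_univ]
  have hGbound : ∫⁻ τ in I₀, gR τ ≤ ENNReal.ofReal ((c : ℝ) * (32 * M) ^ (1 - (1 / 2 : ℝ))) := by
    rw [hTon]
    have hsub : I₀ ×ˢ ball (0 : EuclideanSpace ℝ (Fin 3)) (32 * M) ⊆
        Ioo (-((32 * M) ^ 2)) 0 ×ˢ ball (0 : EuclideanSpace ℝ (Fin 3)) (32 * M) :=
      prod_mono (Ioo_subset_Ioo hMα hτ₀.le) subset_rfl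
    exact (lintegral_mono_set hsub).trans
      (TimePeriodic.setLIntegral_window_le_of_gaugeE (ρ := 1 / 2) (T := (32 * M) ^ 2)
        (by positivity) le_rfl le_rfl (hE (32 * M) (by positivity)))
  have hGfin : ∫⁻ τ in I₀, gR τ ≠ ⊤ := ne_top_of_le_ne_top ENNReal.ofReal_ne_top hGbound
  set g : ℝ → ℝ := fun τ => (gR τ).toReal with hg
  have hgI : IntegrableOn g I₀ volume := integrable_toReal_of_lintegral_ne_top hgRm hGfin
  have hg0 : ∀ τ, 0 ≤ g τ := fun τ => ENNReal.toReal_nonneg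
  have hGle : ∫ τ in I₀, g τ ≤ (c : ℝ) * (32 : ℝ) ^ (1 / 2 : ℝ) * M ^ (1 / 2 : ℝ) := by
    rw [hg, integral_toReal hgRm (ae_lt_top' hgRm hGfin), ← ENNReal.toReal_ofReal (by positivity :
      (0:ℝ) ≤ (c : ℝ) * (32 : ℝ) ^ (1 / 2 : ℝ) * M ^ (1 / 2 : ℝ))]
    refine ENNReal.toReal_mono ENNReal.ofReal_ne_top (hGbound.trans (le_of_eq ?_))
    rw [show (1 : ℝ) - 1 / 2 = 1 / 2 by norm_num, Real.mul_rpow (by norm_num) hM0.le]; ring_nf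
  have hmem : ∀ᵐ τ ∂(volume.restrict I₀), τ ∈ I₀ := ae_restrict_mem measurableSet_Ioo
  -- the one-slice flux bound with the sup window quantity `S`
  have hpt : ∀ᵐ τ : ℝ, τ ∈ I₀ →
      ∫ y in {y : EuclideanSpace ℝ (Fin 3) | M ≤ ‖y‖ ∧ ‖y‖ ≤ 2 * M},
          (‖u τ y‖ ^ 3 + 2 * (|p τ y| * ‖u τ y‖)) ≤
        a₁ * (E₀ ^ (3 / 4 : ℝ) + g τ ^ (3 / 4 : ℝ)) * S ^ (3 / 4 : ℝ) +
          bb * M ^ (-(3 / 2 : ℝ)) * E₀ * Real.sqrt S := by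
    refine (ae_restrict_iff' measurableSet_Ioo).1 ?_
    filter_upwards [hmem, ae_lt_top' hgRm hGfin, ae_restrict_of_ae h8, ae_restrict_of_ae h9, ae_restrict_of_ae hWb,
      ae_restrict_of_ae hWS,
      ae_restrict_of_ae (μ := volume) (s := I₀) hslice, ae_restrict_of_ae (μ := volume) (s := I₀) hEn,
      ae_restrict_of_ae (μ := volume) (s := I₀) h3, ae_restrict_of_ae (μ := volume) (s := I₀) hPV,
      ae_restrict_of_ae (μ := volume) (s := I₀) hPR]
      with τ hτI hgτ h8τ h9τ hWbτ hWSτ hsl hEτ h3τ hPVτ hPRτ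
    have hτ0 : τ < 0 := hI₀0 hτI
    obtain ⟨hsm, -, -, -⟩ := hsl hτI
    obtain ⟨hi2, hiE⟩ := hEτ hτ0
    obtain ⟨heT0, -⟩ := hWbτ hτI
    have heTS : (∫ y in TM, ‖u τ y‖ ^ 2) ≤ S := hWSτ hτI
    have hPτ : ∀ᵐ y ∂volume, ‖y‖ < 16 * M →
        p τ y = rieszPressure ((ball (0 : EuclideanSpace ℝ (Fin 3)) (32 * M)).indicator (u τ)) y +
          ∫ z in {z | 32 * M ≤ ‖z‖}, pressureKernel (y - z) (u τ z) := by
      filter_upwards [hPRτ hτI (32 * M) hMR₁] with y hy h16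
      exact hy (by linarith)
    have hGBτ : (∫⁻ y in ball (0 : EuclideanSpace ℝ (Fin 3)) (32 * M),
        ENNReal.ofReal (frobeniusNormSq (H τ y))) ≤ ENNReal.ofReal (g τ) :=
      le_of_eq (ENNReal.ofReal_toReal hgτ.ne).symm
    have key := hflux (u τ) (p τ) (H τ) hCS hsm hi2 (h3τ hτ0) (hPVτ hτ0) (h8τ hτI) (h9τ hτI) hM (hg0 τ)
      hGBτ hPτ
    have hE2 := Real.rpow_le_rpow (integral_nonneg fun z => by positivity) hiE (by norm_num : (0:ℝ) ≤ 3 / 4)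
    have heT34 : (∫ y in TM, ‖u τ y‖ ^ 2) ^ (3 / 4 : ℝ) ≤ S ^ (3 / 4 : ℝ) :=
      Real.rpow_le_rpow heT0 heTS (by norm_num)
    have hfar : bb * M ^ (-(3 / 2 : ℝ)) * (∫ z, ‖u τ z‖ ^ 2) * Real.sqrt (∫ y in TM, ‖u τ y‖ ^ 2) ≤
        bb * M ^ (-(3 / 2 : ℝ)) * E₀ * Real.sqrt S :=
      mul_le_mul (mul_le_mul_of_nonneg_left hiE (by positivity)) (Real.sqrt_le_sqrt heTS)
        (Real.sqrt_nonneg _) (by positivity)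
    refine key.trans (add_le_add ?_ hfar)
    exact mul_le_mul (mul_le_mul_of_nonneg_left (add_le_add hE2 le_rfl) ha₁) heT34
      (Real.rpow_nonneg heT0 _) (by positivity)
  -- integrate in time: `∫_{I₀} g^{3/4} ≤ T^{1/4} (∫_{I₀} g)^{3/4}`
  have hg34m : AEStronglyMeasurable (fun τ => g τ ^ (3 / 4 : ℝ)) (volume.restrict I₀) :=
    (Real.continuous_rpow_const (by norm_num)).comp_aestronglyMeasurable hgI.aestronglyMeasurable
  have hg34I : IntegrableOn (fun τ => g τ ^ (3 / 4 : ℝ)) I₀ volume := by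
    refine Integrable.mono' (hgI.add (integrable_const 1)) hg34m (Eventually.of_forall fun τ => ?_)
    have h1 : g τ ^ (3 / 4 : ℝ) ≤ g τ + 1 := by
      rcases le_or_gt (g τ) 1 with h | h
      · have := Real.rpow_le_rpow (hg0 τ) h (by norm_num : (0 : ℝ) ≤ 3 / 4)
        rw [Real.one_rpow] at this; linarith [hg0 τ]
      · have := Real.rpow_le_rpow_of_exponent_le h.le (by norm_num : (3 / 4 : ℝ) ≤ 1)
        rw [Real.rpow_one] at this; linarith
    rw [Real.norm_of_nonneg (Real.rpow_nonneg (hg0 τ) _), Pi.add_apply]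
    exact h1
  have hH2 : ∫ τ in I₀, g τ ^ (3 / 4 : ℝ) ≤
      T ^ (1 / 4 : ℝ) * ((c : ℝ) * (32 : ℝ) ^ (1 / 2 : ℝ) * M ^ (1 / 2 : ℝ)) ^ (3 / 4 : ℝ) := by
    have h := setIntegral_rpow_mul_rpow_le (I := I₀) (φ := g) (ψ := fun _ => (1 : ℝ))
      (Eventually.of_forall fun τ => hg0 τ) (Eventually.of_forall fun _ => zero_le_one) hgI
      (by
        haveI := isFiniteMeasure_restrict.2 hI₀vol
        exact integrable_const (1 : ℝ))
    simp only [Real.one_rpow, mul_one, setIntegral_const, smul_eq_mul] at h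
    rw [hTvol] at h
    calc ∫ τ in I₀, g τ ^ (3 / 4 : ℝ) ≤ (∫ τ in I₀, g τ) ^ (3 / 4 : ℝ) * T ^ (1 / 4 : ℝ) := h
      _ ≤ ((c : ℝ) * (32 : ℝ) ^ (1 / 2 : ℝ) * M ^ (1 / 2 : ℝ)) ^ (3 / 4 : ℝ) * T ^ (1 / 4 : ℝ) :=
          mul_le_mul_of_nonneg_right (Real.rpow_le_rpow (setIntegral_nonneg measurableSet_Ioo
            fun τ _ => hg0 τ) hGle (by norm_num)) (by positivity)
      _ = _ := mul_comm _ _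
  have hM38 : ((c : ℝ) * (32 : ℝ) ^ (1 / 2 : ℝ) * M ^ (1 / 2 : ℝ)) ^ (3 / 4 : ℝ) =
      ((c : ℝ) * (32 : ℝ) ^ (1 / 2 : ℝ)) ^ (3 / 4 : ℝ) * M ^ (3 / 8 : ℝ) := by
    rw [Real.mul_rpow (by positivity) (Real.rpow_nonneg hM0.le _), ← Real.rpow_mul hM0.le]
    norm_num
  have hFI : IntegrableOn (fun τ => ∫ y in {y : EuclideanSpace ℝ (Fin 3) | M ≤ ‖y‖ ∧ ‖y‖ ≤ 2 * M},
      (‖u τ y‖ ^ 3 + 2 * (|p τ y| * ‖u τ y‖))) I₀ volume := by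
    set K' : Set (ℝ × EuclideanSpace ℝ (Fin 3)) :=
      Icc α τ₀ ×ˢ closedBall (0 : EuclideanSpace ℝ (Fin 3)) (2 * M) with hK'
    have hK'c : IsCompact K' := isCompact_Icc.prod (isCompact_closedBall _ _)
    have hK'S : K' ⊆ ((slab (EuclideanSpace ℝ (Fin 3)) (Iio 0) isOpen_Iio :
        Opens (ℝ × EuclideanSpace ℝ (Fin 3))) : Set (ℝ × EuclideanSpace ℝ (Fin 3))) := by
      rintro ⟨t, x⟩ ⟨ht, -⟩
      rw [SetLike.mem_coe, mem_slab]
      exact lt_of_le_of_lt ht.2 hτ₀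
    have hFK : IntegrableOn (fun z : ℝ × EuclideanSpace ℝ (Fin 3) =>
        ‖u z.1 z.2‖ ^ 3 + 2 * (|p z.1 z.2| * ‖u z.1 z.2‖))
        (I₀ ×ˢ {y : EuclideanSpace ℝ (Fin 3) | M ≤ ‖y‖ ∧ ‖y‖ ≤ 2 * M}) volume :=
      (((locallyIntegrableOn_cube_of_suitable hsw).integrableOn_compact_subset hK'S hK'c).add
        ((integrableOn_pressure_velocity_of_suitable hsw hK'c hK'S).const_mul 2)).mono_set
        (prod_mono Ioo_subset_Icc_self fun y hy => by
          rw [mem_closedBall, dist_zero_right]; exact hy.2)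
    have h : Integrable (fun z : ℝ × EuclideanSpace ℝ (Fin 3) =>
        ‖u z.1 z.2‖ ^ 3 + 2 * (|p z.1 z.2| * ‖u z.1 z.2‖))
        ((volume.restrict I₀).prod
          (volume.restrict {y : EuclideanSpace ℝ (Fin 3) | M ≤ ‖y‖ ∧ ‖y‖ ≤ 2 * M})) := by
      rw [Measure.prod_restrict, ← Measure.volume_eq_prod]; exact hFK
    exact h.integral_prod_left
  -- the integrand bound `A + B g^{3/4}` and its integral
  set A : ℝ := a₁ * E₀ ^ (3 / 4 : ℝ) * S ^ (3 / 4 : ℝ) + bb * M ^ (-(3 / 2 : ℝ)) * E₀ * Real.sqrt S with hA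
  set B : ℝ := a₁ * S ^ (3 / 4 : ℝ) with hB
  have hABI : IntegrableOn (fun τ => A + B * g τ ^ (3 / 4 : ℝ)) I₀ volume := by
    haveI := isFiniteMeasure_restrict.2 hI₀vol
    exact (integrable_const A).add (hg34I.const_mul B)
  calc ∫ τ in I₀, ∫ y in {y : EuclideanSpace ℝ (Fin 3) | M ≤ ‖y‖ ∧ ‖y‖ ≤ 2 * M},
        (‖u τ y‖ ^ 3 + 2 * (|p τ y| * ‖u τ y‖))
      ≤ ∫ τ in I₀, (A + B * g τ ^ (3 / 4 : ℝ)) := by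
        refine setIntegral_mono_ae_restrict hFI hABI ((ae_restrict_iff' measurableSet_Ioo).2 ?_)
        filter_upwards [hpt] with τ hτ hτI
        refine (hτ hτI).trans (le_of_eq ?_)
        simp only [hA, hB]
        ring
    _ = A * T + B * ∫ τ in I₀, g τ ^ (3 / 4 : ℝ) := by
        haveI := isFiniteMeasure_restrict.2 hI₀vol
        rw [integral_add (integrable_const A) (hg34I.const_mul B), integral_const_mul, setIntegral_const,
          hTvol, smul_eq_mul, mul_comm T A]
    _ ≤ A * T + B * (T ^ (1 / 4 : ℝ) * ((c : ℝ) * (32 : ℝ) ^ (1 / 2 : ℝ) * M ^ (1 / 2 : ℝ)) ^ (3 / 4 : ℝ)) :=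
        add_le_add le_rfl (mul_le_mul_of_nonneg_left hH2 (by positivity))
    _ ≤ a * M ^ (3 / 8 : ℝ) * S ^ (3 / 4 : ℝ) + bb * M ^ (-(3 / 2 : ℝ)) * E₀ * (T * Real.sqrt S) := by
        rw [hM38, hA, hB, ha]
        have hS34 : 0 ≤ S ^ (3 / 4 : ℝ) := Real.rpow_nonneg hS0 _
        have hM1 : (1 : ℝ) ≤ M ^ (3 / 8 : ℝ) := Real.one_le_rpow hM (by norm_num)
        have h1 : a₁ * E₀ ^ (3 / 4 : ℝ) * S ^ (3 / 4 : ℝ) * T ≤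
            a₁ * E₀ ^ (3 / 4 : ℝ) * S ^ (3 / 4 : ℝ) * T * M ^ (3 / 8 : ℝ) := by
          have : a₁ * E₀ ^ (3 / 4 : ℝ) * S ^ (3 / 4 : ℝ) * T * 1 ≤
              a₁ * E₀ ^ (3 / 4 : ℝ) * S ^ (3 / 4 : ℝ) * T * M ^ (3 / 8 : ℝ) :=
            mul_le_mul_of_nonneg_left hM1 (by positivity)
          linarith
        nlinarith [h1, hS34, mul_nonneg (mul_nonneg ha₁ hS34) (by positivity :
          (0:ℝ) ≤ T ^ (1 / 4 : ℝ) * (((c : ℝ) * (32 : ℝ) ^ (1 / 2 : ℝ)) ^ (3 / 4 : ℝ) * M ^ (3 / 8 : ℝ)))]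

end PeriodFlux

end EndpointSobolev

end Summit.NavierStokesRegularity.NavierStokesRegularity.Theorems.PowerGaugeEulerLiouville
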